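import Summits.KontsevichZagierPeriods.KontsevichZagierPeriods.Theorems.FurushoPentagonSectorToKernelRealStokesForm
import Summits.KontsevichZagierPeriods.KontsevichZagierPeriods.Theorems.FurushoPentagonSectorToKernelOfLeaves

/-!
# Line `pi-germ-transfer` of X₂ `AyoubCubeLocalKernel` (stmt-KontsevichZagierPeriods-19074) — the transport stub at `N = 0`, SORRY-FREE

De-risking of `stub_piGermTransport` (crux-strategist r1): its `N = 0` instance — a LOCAL type-(a)
certificate `F_ℂ ∈ kSpan_ℚ {relAC i G}` for the complexified series of a cube representation `s`
already forces `[s] ∈ KZ.relations` — is proved here from the landed S3–S5 chain of line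
`effective-cube-surjection` (crux stmt-10813), by LOCALISING `stub_realStokesForm`: its proof uses
Ayoub's conjecture exactly once (to obtain the certificate), so the same argument runs from the
certificate as a hypothesis (`realStokesForm_of_mem_kSpan`, adapted verbatim), followed by the
calibration steps of `kzKernel_of_cubeResolution_of_ayoubKernel` (semialgebraicity of the primitives,
padding by dummy variables, Stokes-span calibration, un-padding).  What remains of
`stub_piGermTransport` for `N ≥ 1` is therefore ONLY the germ bookkeeping: the same localisation for
the product series `(∏ θ_{m+l}) · F_ℂ` (whose cube representation is `s × [cube^N, ∏ 6/√(4−x_l²)]`)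
and the fixed move chain `[[0,1], 6/√(4−x²)] ∼ [disc, 1]` run fibrewise.

References: J. Ayoub, Ann. of Math. 181 (2015), §1.1; J. Ayoub, EMS Newsl. 91 (2014), Def. 9–10,
Rem. 13; M. Kontsevich, D. Zagier, *Periods* (2001), §1.2.
-/

noncomputable section

-- `Summit.KontsevichZagierPeriods.KontsevichZagierPeriods.…` is the tree's mandated layout (single-conjunct summit).
set_option linter.dupNamespace false

namespace Summit.KontsevichZagierPeriods.KontsevichZagierPeriods.Cruxes.AyoubCubeLocalKernel.PiGermTransfer

open Set MeasureTheory
open Literature.NumberTheory.Transcendental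
open Literature.NumberTheory.Transcendental.KZ hiding cubicalSpan
open Summit.KontsevichZagierPeriods.KontsevichZagierPeriods.Theses.FurushoPentagon
open Summit.KontsevichZagierPeriods.FurushoPentagon.SectorToKernel
open AyoubRel (CSeries Oan intC relAC pdz restrC kSpan DependsOnlyOnLT HasPolyradiusGtOne
  IsAlgebraicOverRatFunc)

/-- **Localised S3** — the real Stokes form of a cube representation from a LOCAL type-(a)
certificate for its complexified series (no conjecture).  Given `s` on `[0,1]ᵐ` whose integrand is the
sum of the real series `F` (majorant of polyradius `ρ > 1`) and a certificate
`F_ℂ ∈ kSpan_ℚ {relAC i G : G ∈ 𝒪_{ℚ-alg}}`, the padded integrand is a finite sum of real Stokes elements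
with real-analytic, `ℚ[x]`-algebraic primitives.
-- adapted from Theorems/FurushoPentagonSectorToKernelRealStokesForm.lean (`stub_realStokesForm`, steps (5)–(10) verbatim)
[cite: Ayoub2015, §1.1] [cite: Ayoub2014, Def. 9–10, Rem. 13] -/
theorem realStokesForm_of_mem_kSpan :
    ∀ (m : ℕ) (s : IntegralRep m), s.domain = KZ.cube m →
    ∀ (F : MvPowerSeries (Fin m) ℝ) (ρ : ℝ), 1 < ρ →
      Summable (fun a : Fin m →₀ ℕ => |MvPowerSeries.coeff a F| * ρ ^ (a.sum fun _ e => e)) →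
      (∀ x ∈ KZ.cube m, HasSum (fun a : Fin m →₀ ℕ => MvPowerSeries.coeff a F * a.prod (fun j e => x j ^ e))
        (s.integrand x)) →
      MvPowerSeries.map (algebraMap ℝ ℂ) (MvPowerSeries.rename (Fin.valEmbedding : Fin m ↪ ℕ) F) ∈
        kSpan (Rat.castHom ℂ) {x : CSeries | ∃ G ∈ Oan (Rat.castHom ℂ), ∃ i : ℕ, x = relAC i G} →
      ∃ (d k : ℕ) (i : Fin k → Fin (m + d)) (H : Fin k → (Fin (m + d) → ℝ) → ℝ),
        (∀ j, AnalyticOnNhd ℝ (H j) (KZ.cube (m + d)) ∧ ∃ P : Polynomial (MvPolynomial (Fin (m + d)) ℚ),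
          P ≠ 0 ∧ ∀ x ∈ KZ.cube (m + d), Polynomial.eval₂
            (MvPolynomial.aeval x : MvPolynomial (Fin (m + d)) ℚ →ₐ[ℚ] ℝ).toRingHom (H j x) P = 0) ∧
        ∀ z ∈ KZ.cube (m + d), s.integrand (fun a => z (Fin.castAdd d a)) =
          ∑ j, (fderiv ℝ (H j) z (Pi.single (i j) 1) - H j (Function.update z (i j) 1) +
            H j (Function.update z (i j) 0)) := by
  intro m s hsd F ρ hρ hsum hF hmem
  have hA := stub_formalIffFunctional
  have hB := stub_analyticOfSummable
  have hC := stub_termwiseOfSummable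
  have hRe := rsf_realify
  have hAlg := rsf_algTransfer
  set Fc : CSeries :=
    MvPowerSeries.map (algebraMap ℝ ℂ) (MvPowerSeries.rename (Fin.valEmbedding : Fin m ↪ ℕ) F)
    with hFc_def
  -- (4′) the LOCAL certificate replaces the leaf
  obtain ⟨n, c, xs, hxs, heq⟩ := hmem
  choose G hG i hxi using hxs
  -- (5) realness of `Fc` and realification
  have hreal : ∀ a : ℕ →₀ ℕ,
      MvPowerSeries.coeff a Fc = (((MvPowerSeries.coeff a Fc).re : ℝ) : ℂ) := by
    intro a
    rw [hFc_def, MvPowerSeries.coeff_map]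
    simp
  have heq1 : Fc = ∑ j, (Rat.castHom ℂ (c j)) • relAC (i j) (G j) := by
    rw [heq]
    refine Finset.sum_congr rfl fun j _ => ?_
    rw [hxi j]
  obtain ⟨hG', heq2⟩ := hRe n c i G Fc hG hreal heq1
  set G' : Fin n → CSeries :=
    fun j => ((c j : ℂ) / 2) • (G j + MvPowerSeries.map (starRingEnd ℂ) (G j)) with hG'_def
  -- (6) data of `G' j ∈ Oan`
  have hG'dep : ∀ j, ∃ m' : ℕ, DependsOnlyOnLT (G' j) m' := fun j => (hG' j).1
  choose mdep hmdep using hG'dep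
  have hG'rad : ∀ j, ∃ r : ℝ, 1 < r ∧
      Summable fun a : ℕ →₀ ℕ => ‖MvPowerSeries.coeff a (G' j)‖ * r ^ (Finsupp.degree a) :=
    fun j => (hG' j).2.1
  choose r hr hrs using hG'rad
  have hG'alg : ∀ j, ∃ P' : Polynomial (MvPolynomial ℕ ℚ), P' ≠ 0 ∧
      Polynomial.eval₂ (AyoubRel.polyToCSeries (Rat.castHom ℂ)) (G' j) P' = 0 :=
    fun j => (hG' j).2.2
  choose P' hP'0 hP' using hG'alg
  -- coefficients of `G' j` are real
  have hG'coeff : ∀ j (a : ℕ →₀ ℕ), MvPowerSeries.coeff a (G' j) =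
      ((((c j : ℝ) * (MvPowerSeries.coeff a (G j)).re : ℝ)) : ℂ) := by
    intro j a
    simp only [hG'_def, MvPowerSeries.coeff_smul, map_add, MvPowerSeries.coeff_map]
    rw [Complex.add_conj, Complex.ofReal_mul]
    push_cast
    ring
  -- (7) the variable bound and the number `d` of dummy variables
  set V : Fin n → ℕ := fun j => ((P' j).support.sup fun k => ((P' j).coeff k).vars.sup id) + 1
    with hV_def
  have hV : ∀ j k, (↑((P' j).coeff k).vars : Set ℕ) ⊆ {l : ℕ | l < V j} := by
    intro j k l hl
    have hl' : l ∈ ((P' j).coeff k).vars := Finset.mem_coe.mp hl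
    have hk : k ∈ (P' j).support := by
      rw [Polynomial.mem_support_iff]
      intro h
      rw [h, MvPolynomial.vars_0] at hl'
      simp at hl'
    have h1 : l ≤ ((P' j).coeff k).vars.sup id := Finset.le_sup (f := id) hl'
    have h2 : ((P' j).coeff k).vars.sup id ≤
        (P' j).support.sup (fun k => ((P' j).coeff k).vars.sup id) :=
      Finset.le_sup (f := fun k => ((P' j).coeff k).vars.sup id) hk
    show l < V j
    rw [hV_def]
    dsimp only
    omega
  set d : ℕ := ∑ j, (mdep j + (i j + 1) + V j) with hd_def
  have hle : ∀ j, mdep j + (i j + 1) + V j ≤ d := fun j =>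
    Finset.single_le_sum (f := fun j => mdep j + (i j + 1) + V j) (fun _ _ => Nat.zero_le _)
      (Finset.mem_univ j)
  have hmD : ∀ j, mdep j ≤ m + d := fun j => by have := hle j; omega
  have hiD : ∀ j, i j < m + d := fun j => by have := hle j; omega
  have hVD : ∀ j, V j ≤ m + d := fun j => by have := hle j; omega
  -- (8) the real series `R j` in `m + d` variables and their sums `H j`
  set e : Fin (m + d) ↪ ℕ := Fin.valEmbedding with he_def
  set i' : Fin n → Fin (m + d) := fun j => ⟨i j, hiD j⟩ with hi'_def
  have hei' : ∀ j, e (i' j) = i j := fun j => rfl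
  set R : Fin n → MvPowerSeries (Fin (m + d)) ℝ :=
    fun j b => (MvPowerSeries.coeff (Finsupp.embDomain e b) (G' j)).re with hR_def
  have hRC : ∀ j (b : Fin (m + d) →₀ ℕ), MvPowerSeries.coeff (Finsupp.embDomain e b) (G' j) =
      ((MvPowerSeries.coeff b (R j) : ℝ) : ℂ) := by
    intro j b
    show _ = (((MvPowerSeries.coeff (Finsupp.embDomain e b) (G' j)).re : ℝ) : ℂ)
    rw [hG'coeff]
    simp
  have hRmap : ∀ j, MvPowerSeries.map (algebraMap ℝ ℂ) (R j) = MvPowerSeries.killCompl e (G' j) := by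
    intro j
    ext b
    rw [MvPowerSeries.coeff_map, MvPowerSeries.coeff_killCompl, hRC]
    rfl
  have hRsum : ∀ j, Summable fun b : Fin (m + d) →₀ ℕ =>
      |MvPowerSeries.coeff b (R j)| * r j ^ (b.sum fun _ e => e) := by
    intro j
    have h1 := (hrs j).comp_injective (Finsupp.embDomain_injective e)
    refine Summable.of_nonneg_of_le (fun b => mul_nonneg (abs_nonneg _) (pow_nonneg (zero_le_one.trans (hr j).le) _)) (fun b => ?_) h1
    simp only [Function.comp_apply, rsf_degree_embDomain, aos_sum_eq_degree]
    refine mul_le_mul_of_nonneg_right ?_ (pow_nonneg (zero_le_one.trans (hr j).le) _)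
    show |(MvPowerSeries.coeff (Finsupp.embDomain e b) (G' j)).re| ≤ _
    exact Complex.abs_re_le_norm _
  have hHex : ∀ j, ∃ H : (Fin (m + d) → ℝ) → ℝ, AnalyticOnNhd ℝ H (KZ.cube (m + d)) ∧
      (∀ x ∈ KZ.cube (m + d), HasSum (fun a : Fin (m + d) →₀ ℕ =>
        MvPowerSeries.coeff a (R j) * a.prod (fun j e => x j ^ e)) (H x)) ∧
      (∀ x ∈ KZ.cube (m + d), ∀ i₀ : Fin (m + d), HasSum (fun a : Fin (m + d) →₀ ℕ =>
        ((a i₀ : ℝ) + 1) * MvPowerSeries.coeff (a + Finsupp.single i₀ 1) (R j) *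
          a.prod (fun j e => x j ^ e)) (fderiv ℝ H x (Pi.single i₀ 1))) :=
    fun j => hB (m + d) (R j) (r j) (hr j) (hRsum j)
  choose H hHan hHsum hHder using hHex
  have hHres : ∀ j (i₀ : Fin (m + d)) (c₀ : ℝ), 0 ≤ c₀ → c₀ ≤ 1 → ∀ x ∈ KZ.cube (m + d),
      HasSum (fun a : Fin (m + d) →₀ ℕ => (if a i₀ = 0 then
        ∑' n : ℕ, MvPowerSeries.coeff (a + Finsupp.single i₀ n) (R j) * c₀ ^ n else 0) *
          a.prod (fun j e => x j ^ e)) (H j (Function.update x i₀ c₀)) :=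
    fun j => (hC (m + d) (R j) (r j) (hr j) (hRsum j) (H j) (hHsum j)).2
  refine ⟨d, n, i', H, fun j => ⟨hHan j, ?_⟩, fun z hz => ?_⟩
  · -- (9) algebraicity of `H j`
    have hvars : ∀ k : ℕ, (↑((P' j).coeff k).vars : Set ℕ) ⊆ {l : ℕ | l < m + d} :=
      fun k l hl => lt_of_lt_of_le (hV j k hl) (hVD j)
    obtain ⟨P'', hP''0, hP''R⟩ := hAlg (m + d) (G' j) (R j) (P' j) (hRmap j) (hP'0 j) hvars (hP' j)
    exact ⟨P'', hP''0, (hA (m + d) (R j) (r j) (hr j) (hRsum j) (H j) (hHsum j) P'').mp hP''R⟩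
  · -- (10) the identity on the cube
    set x : Fin m → ℝ := fun a => z (Fin.castAdd d a) with hx_def
    have hx : x ∈ KZ.cube m := fun a => hz (Fin.castAdd d a)
    -- the real coefficient of the `j`-th Stokes element at the exponent `b`
    set E : Fin n → (Fin (m + d) →₀ ℕ) → ℝ := fun j b =>
      ((b (i' j) : ℝ) + 1) * MvPowerSeries.coeff (b + Finsupp.single (i' j) 1) (R j) -
        (if b (i' j) = 0 then
          ∑' k : ℕ, MvPowerSeries.coeff (b + Finsupp.single (i' j) k) (R j) * (1 : ℝ) ^ k else 0) +
        (if b (i' j) = 0 then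
          ∑' k : ℕ, MvPowerSeries.coeff (b + Finsupp.single (i' j) k) (R j) * (0 : ℝ) ^ k else 0)
      with hE_def
    -- (10a) the coefficient identity
    have hcoef : ∀ b : Fin (m + d) →₀ ℕ,
        MvPowerSeries.coeff (Finsupp.embDomain e b) Fc = ((∑ j, E j b : ℝ) : ℂ) := by
      intro b
      rw [heq2, map_sum, Complex.ofReal_sum]
      refine Finset.sum_congr rfl fun j _ => ?_
      change MvPowerSeries.coeff (Finsupp.embDomain e b) (relAC (i j) (G' j)) = ((E j b : ℝ) : ℂ)
      have hι : (Finsupp.embDomain e b) (i j) = b (i' j) := by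
        show Finsupp.embDomain e b (e (i' j)) = b (i' j)
        exact Finsupp.embDomain_apply_self e b (i' j)
      have hadd : ∀ k : ℕ, Finsupp.embDomain e b + Finsupp.single (i j) k =
          Finsupp.embDomain e (b + Finsupp.single (i' j) k) := by
        intro k
        rw [Finsupp.embDomain_add, Finsupp.embDomain_single]
        rfl
      rw [rsf_coeff_relAC, rre_coeff_pdz, rre_coeff_restrC, rre_coeff_restrC, hι]
      simp_rw [hadd, hRC]
      simp only [hE_def]
      by_cases hb : b (i' j) = 0
      · rw [if_pos hb, if_pos hb, if_pos hb, if_pos hb]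
        push_cast
        ring
      · rw [if_neg hb, if_neg hb, if_neg hb, if_neg hb]
        push_cast
        ring
    -- (10b) the padded integrand as the sum of the complexified series
    have hLHS : HasSum (fun b : Fin (m + d) →₀ ℕ =>
        (MvPowerSeries.coeff (Finsupp.embDomain e b) Fc).re * b.prod (fun j e => z j ^ e))
        (s.integrand x) := by
      have hinj : Function.Injective
          (Finsupp.mapDomain (Fin.castAdd d) : (Fin m →₀ ℕ) → (Fin (m + d) →₀ ℕ)) :=
        Finsupp.mapDomain_injective (Fin.castAdd_injective m d)
      refine (hinj.hasSum_iff ?_).mp ?_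
      · intro b hb
        have h0 : MvPowerSeries.coeff (Finsupp.embDomain e b) Fc = 0 := by
          rw [hFc_def, MvPowerSeries.coeff_map, MvPowerSeries.coeff_rename_eq_zero, map_zero]
          rintro ⟨a, ha⟩
          apply hb
          refine ⟨a, Finsupp.embDomain_injective e ?_⟩
          rw [rsf_embDomain_mapDomain_castAdd, Finsupp.embDomain_eq_mapDomain]
          exact ha
        rw [h0, Complex.zero_re, zero_mul]
      · have h := hF x hx
        convert h using 1
        funext a
        simp only [Function.comp_apply]
        rw [rsf_embDomain_mapDomain_castAdd, hFc_def, MvPowerSeries.coeff_map,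
          MvPowerSeries.coeff_embDomain_rename,
          Finsupp.prod_mapDomain_index_inj (Fin.castAdd_injective m d)]
        simp [hx_def]
    -- (10c) the sum of the Stokes elements
    have hRHS : HasSum (fun b : Fin (m + d) →₀ ℕ => (∑ j, E j b) * b.prod (fun j e => z j ^ e))
        (∑ j, (fderiv ℝ (H j) z (Pi.single (i' j) 1) - H j (Function.update z (i' j) 1) +
          H j (Function.update z (i' j) 0))) := by
      simp_rw [Finset.sum_mul]
      refine hasSum_sum fun j _ => ?_
      have h1 := hHder j z hz (i' j)
      have h2 := hHres j (i' j) 1 zero_le_one le_rfl z hz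
      have h3 := hHres j (i' j) 0 le_rfl zero_le_one z hz
      have h4 := (h1.sub h2).add h3
      have hfun : (fun b : Fin (m + d) →₀ ℕ => E j b * b.prod (fun j e => z j ^ e)) =
          fun a : Fin (m + d) →₀ ℕ =>
            ((a (i' j) : ℝ) + 1) * MvPowerSeries.coeff (a + Finsupp.single (i' j) 1) (R j) *
                a.prod (fun j e => z j ^ e) -
              (if a (i' j) = 0 then ∑' n : ℕ,
                MvPowerSeries.coeff (a + Finsupp.single (i' j) n) (R j) * (1 : ℝ) ^ n else 0) *
                a.prod (fun j e => z j ^ e) +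
              (if a (i' j) = 0 then ∑' n : ℕ,
                MvPowerSeries.coeff (a + Finsupp.single (i' j) n) (R j) * (0 : ℝ) ^ n else 0) *
                a.prod (fun j e => z j ^ e) := by
        funext b
        simp only [hE_def]
        ring
      rw [hfun]
      exact h4
    -- (10d) conclusion
    have hLHS' : HasSum (fun b : Fin (m + d) →₀ ℕ => (∑ j, E j b) * b.prod (fun j e => z j ^ e))
        (s.integrand x) := by
      convert hLHS using 1
      funext b
      rw [hcoef, Complex.ofReal_re]
    exact hLHS'.unique hRHS


/-- **`stub_piGermTransport` at `N = 0`, sorry-free**: a local type-(a) certificate for the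
complexified series of a cube representation `s` (empty germ product) forces `[s] ∈ KZ.relations` —
localised S3 above, then S4 (semialgebraicity of the primitives), padding by dummy variables, S5
(Stokes-span calibration) and un-padding, exactly as in `kzKernel_of_cubeResolution_of_ayoubKernel`.
The pinned disc product `P` is carried only to exhibit the shape of the stub (`(⋯)^[0] = id`).
[cite: KontsevichZagier2001, §1.2] [cite: Ayoub2014, Rem. 12–13] -/
theorem piGermTransport_zero
    (P : ∀ n : ℕ, IntegralRep n → IntegralRep (n + 2))
    (m : ℕ) (s : IntegralRep m) (hsd : s.domain = KZ.cube m)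
    (F : MvPowerSeries (Fin m) ℝ) (ρ : ℝ) (hρ : 1 < ρ)
    (hsum : Summable (fun a : Fin m →₀ ℕ => |MvPowerSeries.coeff a F| * ρ ^ (a.sum fun _ e => e)))
    (hF : ∀ x ∈ KZ.cube m, HasSum (fun a : Fin m →₀ ℕ => MvPowerSeries.coeff a F * a.prod (fun j e => x j ^ e))
      (s.integrand x))
    (hmem : MvPowerSeries.map (algebraMap ℝ ℂ) (MvPowerSeries.rename (Fin.valEmbedding : Fin m ↪ ℕ) F) ∈
      kSpan (Rat.castHom ℂ) {x : CSeries | ∃ G ∈ Oan (Rat.castHom ℂ), ∃ i : ℕ, x = relAC i G}) :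
    (⇑(FreeAbelianGroup.lift (fun t : (Σ n, IntegralRep n) => of (P t.1 t.2))))^[0] (of s) ∈ relations := by
  rw [Function.iterate_zero, id_eq]
  -- localised S3
  obtain ⟨d, k, i, H, hH, hid⟩ := realStokesForm_of_mem_kSpan m s hsd F ρ hρ hsum hF hmem
  -- S4: the primitives are `ℚ`-semialgebraic on the cube
  have hHs : ∀ j, AnalyticOnNhd ℝ (H j) (KZ.cube (m + d)) ∧
      IsSemialgebraicFunOn ℚ (KZ.cube (m + d)) (H j) :=
    fun j => ⟨(hH j).1, stub_semialgebraicOfAlgebraic (m + d) (H j) (hH j).1 (hH j).2⟩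
  -- pad `s` by `d` dummy variables; S5: a sum of Stokes elements along any coordinates is a relation
  obtain ⟨u, hud, hui⟩ := leaves_exists_oneCube d
  have htd : (s.prod u).domain = KZ.cube (m + d) := by
    rw [IntegralRep.prod_domain, leaves_prodDomain_eq_cube s u hsd hud]
  have hti : ∀ z ∈ KZ.cube (m + d), (s.prod u).integrand z =
      ∑ j, (fderiv ℝ (H j) z (Pi.single (i j) 1) - H j (Function.update z (i j) 1) +
        H j (Function.update z (i j) 0)) := by
    intro z hz
    rw [leaves_prod_oneCube_integrand s u hui z]
    exact hid z hz
  have ht : of (s.prod u) ∈ relations :=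
    stub_stokesSpanCalibration (m + d) (s.prod u) htd k i H hHs hti
  -- un-pad
  have hst : of s - of (s.prod u) ∈ relations := leaves_of_sub_of_prod_oneCube s u hud hui
  have hsplit : of s = (of s - of (s.prod u)) + of (s.prod u) := by abel
  rw [hsplit]
  exact relations.add_mem hst ht

end Summit.KontsevichZagierPeriods.KontsevichZagierPeriods.Cruxes.AyoubCubeLocalKernel.PiGermTransfer
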